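import Summits.PneNP.PneNP.Theorems.SymmetryBudgetNoHiddenOrderPerPathReplay

/-!
# Height-coloured labels exist and are cheap: `col(x_k) ≤ d_k` (`NoHiddenOrder`, PER-PATH.md §12, brick B4)

Route `PneNP/SymmetryBudget`, `NoHiddenOrder` (stmt-PneNP-14781). For the timed path of OR-choices `x 0, …, x (t-1)` of a pointer
`v` (`timed`, `IsORChoice`, `…PerPathReplay.lean`) we construct the HEIGHT COLOURING of its points and bound it:

* `Dset … k` — the later indices `i` whose point lies in the cell from which `x k` was taken; `height … k = 1 + max_{i ∈ Dset k}
  height i` (downward recursion); `heightLabel` — the colouring `x k ↦ height k`, `0` off the points;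
* `heightColoured_heightLabel` — it is `HeightColoured` (so `replay_root` applies: the label replays the path exactly);
* `height_le` — `height k ≤ 1 + |Dset k|` (the sets `Dset` are nested along a chain: colours nest along the path,
  `timed_col_eq_of_le`), and `card_Dset_lt` — `|Dset k| < |smallestCell_k|` (the points are distinct members of that cell); hence
  **`heightLabel_le_d`**: `1 ≤ heightLabel (x k) ≤ |smallestCell_k| = d_k`;
* **`sum_codeLen_heightLabel_le`** — `Σ_{k<t} (2·⌊log₂ heightLabel (x k)⌋ + 1) ≤ t + 2·Σ_{k<t} ⌊log₂ d_k⌋` with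
  `d_k = |smallestCell_k|`: with seat 0's Kraft inequality `AdviceEntropy.factorial_le_advice_bound` this is the label entropy
  `≤ n + t + 2 Σ log₂ d` of PER-PATH §3/§12, and with `ORSteps.sum_log_d_le` (`…PerPathProcess.lean`; the timed path of the
  process is an `ORSteps` with these `d_k`) it is `O(n)`.

So every node of the components-only recursion tree is reached by the replay of a label of linear entropy.
Definitions: `Dset`, `height`, `heightLabel`; no choice.
-/

-- `Summit.PneNP.PneNP.…` duplicates `PneNP` BY DESIGN (single-problem summit, D-0017 layout).
set_option linter.dupNamespace false

namespace Summit.PneNP.PneNP.Theorems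

open Finset

namespace BranchSum

variable {V : Type*} [DecidableEq V] (G : SimpleGraph V) [DecidableRel G.Adj]
variable (v : V) (St : Finset V × (V → ℕ)) (x : ℕ → V) (t : ℕ)

/-- The later indices whose point lies in the cell from which `x k` was taken (the conflicts of `k`). -/
noncomputable def Dset (k : ℕ) : Finset ℕ :=
  (range t).filter fun i => k < i ∧ x i ∈ cellOf (timed G v St x k).1 (timed G v St x k).2 (x k)

variable {G v St x t}

/-- Membership in `Dset`. -/
theorem mem_Dset {k i : ℕ} : i ∈ Dset G v St x t k ↔ i < t ∧ k < i ∧ x i ∈ cellOf (timed G v St x k).1 (timed G v St x k).2 (x k) := by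
  unfold Dset; rw [mem_filter, mem_range]

variable (G v St x t)

/-- The HEIGHT of index `k`: one more than the largest height of a conflict (downward recursion on `t - k`). -/
noncomputable def height (k : ℕ) : ℕ :=
  1 + ((Dset G v St x t k).attach).sup fun i => height i.1
termination_by t - k
decreasing_by
  have hi := mem_Dset.1 i.2
  omega

/-- The HEIGHT LABEL: `x k ↦ height k` on the points, `0` elsewhere (a `sup` over the at most one index with `x k = y`). -/
noncomputable def heightLabel (y : V) : ℕ := ((range t).filter fun k => x k = y).sup fun k => height G v St x t k

variable {G v St x t}

/-- Unfolding `height`. -/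
theorem height_eq (k : ℕ) : height G v St x t k = 1 + ((Dset G v St x t k).attach).sup fun i => height G v St x t i.1 := by
  rw [height]

/-- Heights are positive. -/
theorem one_le_height (k : ℕ) : 1 ≤ height G v St x t k := by rw [height_eq]; exact Nat.le_add_right _ _

/-- A conflict has a smaller height. -/
theorem height_lt_of_mem_Dset {k i : ℕ} (hi : i ∈ Dset G v St x t k) : height G v St x t i < height G v St x t k := by
  rw [height_eq k]
  have : height G v St x t i ≤ ((Dset G v St x t k).attach).sup fun j => height G v St x t j.1 :=
    le_sup (f := fun j : {j // j ∈ Dset G v St x t k} => height G v St x t j.1) (mem_attach _ ⟨i, hi⟩)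
  omega

/-! ### Colours nest along the timed path; `Dset` is nested along chains -/

/-- Later colourings refine earlier ones on the later block. -/
theorem timed_col_eq_of_le {k k' : ℕ} (h : k ≤ k') {u w : V} (hu : u ∈ (timed G v St x k').1) (hw : w ∈ (timed G v St x k').1)
    (huw : (timed G v St x k').2 u = (timed G v St x k').2 w) : (timed G v St x k).2 u = (timed G v St x k).2 w := by
  induction h with
  | refl => exact huw
  | step hle ih =>
    rename_i k'
    apply ih (atom_subset _ _ _ hu) (atom_subset _ _ _ hw)
    -- `col (k'+1) = refineIn A_{k'} (indiv col_{k'} (x k'))` refines `indiv`, which refines `col k'`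
    have h1 := refineIn_refines (G := G) (indiv (timed G v St x k').2 (x k')) (atom_subset _ _ _ hu) (atom_subset _ _ _ hw) huw
    exact indiv_refines _ _ h1

section Bounds

variable (hOR : IsORChoice G v St x t) (hv : ∀ k, k < t → x k ≠ v)
include hOR hv

omit hv in
/-- `Dset` is nested along a chain: the conflicts of a conflict of `k` are conflicts of `k`. -/
theorem Dset_subset_of_mem {k i : ℕ} (hi : i ∈ Dset G v St x t k) : Dset G v St x t i ⊆ (Dset G v St x t k).erase i := by
  intro j hj
  obtain ⟨hit, hki, hxi⟩ := mem_Dset.1 hi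
  obtain ⟨hjt, hij, hxj⟩ := mem_Dset.1 hj
  rw [mem_erase]
  refine ⟨Nat.ne_of_gt hij, mem_Dset.2 ⟨hjt, hki.trans hij, ?_⟩⟩
  rw [mem_cellOf_iff] at hxi hxj ⊢
  refine ⟨timed_fst_subset_of_le hki.le hxj.1, ?_⟩
  rw [← hxi.2]
  exact timed_col_eq_of_le hki.le hxj.1 (smallestCell_subset _ _ (hOR i hit).2) hxj.2

omit hv in
/-- **`height k ≤ 1 + |Dset k|`.** -/
theorem height_le (k : ℕ) : height G v St x t k ≤ 1 + (Dset G v St x t k).card := by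
  -- strong induction on the size of `Dset`
  suffices key : ∀ m k, (Dset G v St x t k).card ≤ m → height G v St x t k ≤ 1 + (Dset G v St x t k).card from key _ k le_rfl
  intro m
  induction m with
  | zero =>
    intro k hk
    have hD : Dset G v St x t k = ∅ := card_eq_zero.1 (Nat.le_zero.1 hk)
    rw [height_eq, hD]
    simp
  | succ m ih =>
    intro k hk
    rw [height_eq]
    rcases (Dset G v St x t k).eq_empty_or_nonempty with hD | hD
    · rw [hD]; simp
    · -- the sup is attained at a conflict `i`, whose conflicts are strictly fewer
      obtain ⟨i, hi, hsup⟩ := exists_mem_eq_sup ((Dset G v St x t k).attach) (attach_nonempty_iff.2 hD)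
        (fun j => height G v St x t j.1)
      rw [hsup]
      have hsub := Dset_subset_of_mem hOR i.2
      have hcard : (Dset G v St x t i.1).card + 1 ≤ (Dset G v St x t k).card := by
        have := card_le_card hsub
        rw [card_erase_of_mem i.2] at this
        have hpos : 0 < (Dset G v St x t k).card := card_pos.2 hD
        omega
      have := ih i.1 (by omega)
      omega

/-- **`|Dset k| < |smallestCell_k|`**: the conflicts are distinct points of the cell of `x k`, other than `x k`. -/
theorem card_Dset_lt {k : ℕ} (hk : k < t) :
    (Dset G v St x t k).card < (smallestCell (timed G v St x k).1 (timed G v St x k).2).card := by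
  rw [smallestCell_eq_cellOf _ (hOR k hk).2]
  have hinj : Set.InjOn x ↑(Dset G v St x t k) := fun i hi j hj hij =>
    x_injective hOR hv (mem_Dset.1 (mem_coe.1 hi)).1 (mem_Dset.1 (mem_coe.1 hj)).1 hij
  rw [← card_image_of_injOn hinj]
  apply card_lt_card
  refine ⟨image_subset_iff.2 fun i hi => (mem_Dset.1 hi).2.2, fun hsub => ?_⟩
  have hxk : x k ∈ cellOf (timed G v St x k).1 (timed G v St x k).2 (x k) :=
    mem_cellOf_iff.2 ⟨smallestCell_subset _ _ (hOR k hk).2, rfl⟩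
  obtain ⟨i, hi, hix⟩ := mem_image.1 (hsub hxk)
  have := x_injective hOR hv (mem_Dset.1 hi).1 hk hix
  exact absurd this (Nat.ne_of_gt (mem_Dset.1 hi).2.1)

/-- The height label of a point is its height. -/
theorem heightLabel_apply {k : ℕ} (hk : k < t) : heightLabel G v St x t (x k) = height G v St x t k := by
  unfold heightLabel
  have : ((range t).filter fun j => x j = x k) = {k} := by
    ext j
    rw [mem_filter, mem_range, mem_singleton]
    exact ⟨fun h => x_injective hOR hv h.1 hk h.2, fun h => by subst h; exact ⟨hk, rfl⟩⟩
  rw [this, sup_singleton]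

/-- **The height label is a height colouring** (so `replay_root` applies to it). -/
theorem heightColoured_heightLabel : HeightColoured G v St x t (heightLabel G v St x t) := by
  intro k i hki hit hxi
  rw [heightLabel_apply hOR hv hit, heightLabel_apply hOR hv (hki.trans hit)]
  exact height_lt_of_mem_Dset (mem_Dset.2 ⟨hit, hki, hxi⟩)

/-- **`1 ≤ heightLabel (x k) ≤ d_k = |smallestCell_k|`.** -/
theorem heightLabel_le_d {k : ℕ} (hk : k < t) :
    1 ≤ heightLabel G v St x t (x k) ∧
      heightLabel G v St x t (x k) ≤ (smallestCell (timed G v St x k).1 (timed G v St x k).2).card := by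
  rw [heightLabel_apply hOR hv hk]
  refine ⟨one_le_height k, ?_⟩
  have h1 := height_le hOR k
  have h2 := card_Dset_lt hOR hv hk
  omega

/-- **Code length of the height label**: `Σ_{k<t} (2⌊log₂ heightLabel (x k)⌋ + 1) ≤ t + 2 Σ_{k<t} ⌊log₂ |smallestCell_k|⌋`. -/
theorem sum_codeLen_heightLabel_le :
    ∑ k ∈ range t, (2 * Nat.log 2 (heightLabel G v St x t (x k)) + 1) ≤
      t + 2 * ∑ k ∈ range t, Nat.log 2 (smallestCell (timed G v St x k).1 (timed G v St x k).2).card := by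
  rw [sum_add_distrib, sum_const, card_range, smul_eq_mul, mul_one, ← mul_sum, add_comm]
  refine Nat.add_le_add_left (Nat.mul_le_mul_left 2 (sum_le_sum fun k hk => ?_)) t
  exact Nat.log_mono_right (heightLabel_le_d hOR hv (mem_range.1 hk)).2

end Bounds

end BranchSum

end Summit.PneNP.PneNP.Theorems
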